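import Literature.AnabelianGeometry.SemiGraphs.TreeSystemFixedCrossings
import Literature.AnabelianGeometry.SemiGraphs.SemiGraphTreeNoTriangle
import HarnessLib

/-!
# Unfolded fixed subjoints and edge-sized images of fixed loci ([SemiAnbd] Thm. 3.7 (iii), p. 41)

Mochizuki, *Semi-graphs of anabelioids*, Publ. RIMS **42** (2006), §3, Theorem 3.7 (iii), author's
manuscript p. 41, third paragraph of the proof, with the author's *Comments* (2020), item (6)(b): "each
of the nonempty sets `E_{j,i}`, for `i` sufficiently large relative to `j`, is of cardinality 1" — the
IMAGE at a fixed level of the fixed locus of a deep level is small. [cite: MochizukiSemiAnbd2006, Thm. 3.7(iii) p.41]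

PROOF-ONLY, GENERIC tool file (cell abc-iut, layer L3, GAP row G-t6g3-2b «Thm 3.7 (iii)/Cor 3.9 beyond
finite 𝒢», sub-row (B3) of abc-iut-w6-d066's «T37iii·LOCFIN-PERSIST», pieces (B3-S)/(B3-U); seat
abc-iut-w5-d212; no definition, no named fact, nothing specific to anabelioids).  Currency: a group `P`
acting on a TREE `T` (`ρ : P →* Aut T`), a morphism `f : T ⟶ T'` to a tree `T'` (one transition map of a
level system), a subgroup `C ≤ P` — the single-transition form of the `(T, f, ρ)` systems of
`TreeSystemBoundedGeodesics.lean` (abc-iut-w5-d160).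

* `SemiGraph.exists_fixedSubjoint_lastDeparture_of_fixed` — the CROSSING LEMMA of abc-iut-w5-d160
  (`exists_fixedSubjoint_lastDeparture`, `TreeSystemFixedCrossings.lean`) for ONE transition and two
  `C`-fixed vertices `x₁, x₂` of `T` (instead of two compatible fixed SYSTEMS): if the geodesic of `T'`
  from `f x₁` to `f x₂` has an interior vertex `u` (node `4`) with branch `β₁` (node `3`) on the
  `f x₁`-side, then `T` carries a `C`-fixed subjoint `(y; δ₁ ≠ δ)` over `u` that is UNFOLDED by `f`
  (`f δ₁ = β₁ ≠ f δ`).  Proof verbatim that of loc. cit. (image walk, last departure from `β₁`,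
  `Walk.bypass` + `IsAcyclic.path_unique`, Lem. 1.8 (ii)(b) fixing the geodesic) — adapted, not imported,
  because the system version quantifies over globally compatible families.
* `SemiGraph.eq_or_joins_of_noUnfoldedFixedSubjoint` — hence, if NO `C`-fixed subjoint of `T` is
  unfolded by `f`, the images of any two `C`-fixed vertices of `T` are EQUAL or JOINED BY AN EDGE of `T'`
  (a geodesic of length `> 4` in the subdivision has an interior vertex; `joins_of_path_length_four`);
* `SemiGraph.image_fixed_pairwise_third` — and among any three such images two coincide (a tree has no
  triangle, `IsTree.no_triangle`): the image of the `C`-fixed vertex locus of `T` lies in the two ends of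
  ONE edge of `T'` (or is a single vertex), in particular it is finite
  (`SemiGraph.finite_image_fixed_of_noUnfoldedFixedSubjoint`).

These are the tree-combinatorial half of «uniform kill ⇒ edge-sized images ⇒ (FIX∞)»: the hypothesis
«no unfolded fixed subjoint at deep levels» is what total estrangement supplies per base subjoint
(abc-iut-w5-d189 `eq_bot_of_fixedSubjoints_over`, abc-iut-L3-t10 `eq_bot_of_fixedSubjointSystem`) and
UNIFORMLY at a finite `𝔾`; the (FIX∞) assembly over `VerticialLevelData` is abc-iut-w6-d066's
`hfix_of_eventually_finite_images` / `hadj_of_eventually_edge_images`.  HONEST LIMIT: nothing here asserts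
the «no unfolded fixed subjoint» hypothesis for any `𝒢` (it FAILS along the escaping ray of the
countermodel `𝒢_θ` of abc-iut-L3-d1, `ThetaRayEscape.lean`); nothing bears on [IUTchIII] Cor. 3.12.
-/

namespace Literature.AnabelianGeometry.SemiGraphs

namespace SemiGraph

open CategoryTheory

universe u

section OneTransition

variable {P : Type u} [Group P] (C : Subgroup P) {T T' : SemiGraph.{u}}

/-- **Crossing lemma, single transition** (abc-iut-w5-d160's `exists_fixedSubjoint_lastDeparture` for two
`C`-fixed vertices of ONE level): `T`, `T'` trees, `ρ : P →* Aut T`, `f : T ⟶ T'`, `x₁, x₂` vertices of `T`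
fixed by `C`, `p` the geodesic of `T'` from `f x₁` to `f x₂` of length `> 4` with nodes `2, 3, 4` the
edge-point `e₁`, the branch-point `β₁` and the vertex-point `u`.  Then there is a `C`-fixed subjoint
`(y; δ₁ ≠ δ)` of `T` with `f y = u`, `f δ₁ = β₁` and `f δ ≠ β₁` a branch at `u`: the image of the
`T`-geodesic `x₁ ⇝ x₂` covers `p`, and at its LAST DEPARTURE from `β₁` it steps `β₁ → u → β`, `β ≠ β₁`.
[cite: MochizukiSemiAnbd2006, Thm. 3.7(iii) p.41] -/
theorem exists_fixedSubjoint_lastDeparture_of_fixed (hT : T.IsTree) (hT' : T'.IsTree)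
    (ρ : P →* Aut T) (f : T ⟶ T') (x₁ x₂ : T.Vertex)
    (hfx₁ : ∀ γ : C, (ρ γ).hom.vertexMap x₁ = x₁) (hfx₂ : ∀ γ : C, (ρ γ).hom.vertexMap x₂ = x₂)
    (p : T'.subdivision.Walk (Sum.inl (f.vertexMap x₁)) (Sum.inl (f.vertexMap x₂))) (hp : p.IsPath)
    (h4 : 4 < p.length) {e₁ : T'.Edge} {β₁ : T'.Branch} {u : T'.Vertex}
    (h2 : p.getVert 2 = Sum.inr (Sum.inl e₁)) (h3 : p.getVert 3 = Sum.inr (Sum.inr β₁))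
    (h4u : p.getVert 4 = Sum.inl u) (hβ₁e : T'.edgeOf β₁ = e₁) (hβ₁u : T'.abuts β₁ = some u) :
    ∃ (y : T.Vertex) (δ₁ δ : T.Branch), δ₁ ≠ δ ∧ T.abuts δ₁ = some y ∧ T.abuts δ = some y ∧
      f.vertexMap y = u ∧ f.branchMap δ₁ = β₁ ∧ f.branchMap δ ≠ β₁ ∧
      T'.abuts (f.branchMap δ) = some u ∧
      ∀ γ : C, (ρ γ).hom.vertexMap y = y ∧ (ρ γ).hom.branchMap δ₁ = δ₁ ∧ (ρ γ).hom.branchMap δ = δ := by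
  classical
  have hA : T'.subdivision.IsAcyclic := hT'.isTree.isAcyclic
  -- the upper geodesic `q` and its image walk `W`
  obtain ⟨q, hq⟩ := hT.isTree.connected.exists_walk_length_eq_dist (Sum.inl x₁) (Sum.inl x₂)
  have hqpath : q.IsPath := q.isPath_of_length_eq_dist hq
  let Φ : T.subdivision →g T'.subdivision :=
    ⟨Sum.map f.vertexMap (Sum.map f.edgeMap f.branchMap), fun hab => subdivision_adj_map f hab⟩
  have hΦv : ∀ w : T.Vertex, Φ (Sum.inl w) = Sum.inl (f.vertexMap w) := fun _ => rfl
  have hΦe : ∀ e : T.Edge, Φ (Sum.inr (Sum.inl e)) = Sum.inr (Sum.inl (f.edgeMap e)) := fun _ => rfl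
  have hΦb : ∀ b : T.Branch, Φ (Sum.inr (Sum.inr b)) = Sum.inr (Sum.inr (f.branchMap b)) := fun _ => rfl
  let W : T'.subdivision.Walk (Sum.inl (f.vertexMap x₁)) (Sum.inl (f.vertexMap x₂)) :=
    (q.map Φ).copy (hΦv x₁) (hΦv x₂)
  have hWq : ∀ t, W.getVert t = Φ (q.getVert t) := fun t => by
    simp only [W, SimpleGraph.Walk.getVert_copy, SimpleGraph.Walk.getVert_map]
  have hWlen : W.length = q.length := by
    simp only [W, SimpleGraph.Walk.length_copy, SimpleGraph.Walk.length_map]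
  -- `W` covers `p`: in particular it visits the branch-point `β₁`
  have hcover : p.support ⊆ W.support := by
    have hb : W.bypass = p := congrArg Subtype.val (hA.path_unique ⟨W.bypass, W.bypass_isPath⟩ ⟨p, hp⟩)
    rw [← hb]
    exact W.support_bypass_subset_support
  have hβ₁W : (Sum.inr (Sum.inr β₁) : T'.Node) ∈ W.support := by
    apply hcover
    rw [← h3]
    exact p.getVert_mem_support 3
  -- the LAST visit `t₀` of `W` to `β₁`
  obtain ⟨m₀, hm₀, hm₀le⟩ := SimpleGraph.Walk.mem_support_iff_exists_getVert.mp hβ₁W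
  set t₀ := Nat.findGreatest (fun t => W.getVert t = Sum.inr (Sum.inr β₁)) W.length with ht₀def
  have ht₀ : W.getVert t₀ = Sum.inr (Sum.inr β₁) :=
    Nat.findGreatest_spec (P := fun t => W.getVert t = Sum.inr (Sum.inr β₁)) hm₀le hm₀
  have ht₀le : t₀ ≤ W.length := Nat.findGreatest_le _
  have hmax : ∀ t, t₀ < t → t ≤ W.length → W.getVert t ≠ Sum.inr (Sum.inr β₁) := fun t ht htl =>
    Nat.findGreatest_is_greatest (P := fun t => W.getVert t = Sum.inr (Sum.inr β₁)) ht htl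
  have ht₀lt : t₀ < W.length := by
    rcases Nat.lt_or_ge t₀ W.length with hlt | hge
    · exact hlt
    · exfalso
      have : W.getVert t₀ = Sum.inl (f.vertexMap x₂) := by
        rw [le_antisymm ht₀le hge]; exact W.getVert_length
      rw [ht₀] at this
      exact Sum.inr_ne_inl this
  -- the next node is the vertex-point `u` (not the edge-point `e₁`: the suffix would have to return through `β₁`)
  have hstep : W.getVert (t₀ + 1) = Sum.inl u := by
    have hadj := W.adj_getVert_succ ht₀lt
    rw [ht₀, subdivision_adj_branch_iff] at hadj
    rcases hadj with hE | ⟨w, hw, hE⟩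
    · exfalso
      rw [hβ₁e] at hE
      let W' : T'.subdivision.Walk (Sum.inr (Sum.inl e₁)) (Sum.inl (f.vertexMap x₂)) :=
        (W.drop (t₀ + 1)).copy hE rfl
      let p₂ : T'.subdivision.Walk (Sum.inr (Sum.inl e₁)) (Sum.inl (f.vertexMap x₂)) :=
        (p.drop 2).copy h2 rfl
      have hp₂ : p₂.IsPath := by
        simpa only [p₂, SimpleGraph.Walk.isPath_copy] using hp.drop 2
      have hb : W'.bypass = p₂ :=
        congrArg Subtype.val (hA.path_unique ⟨W'.bypass, W'.bypass_isPath⟩ ⟨p₂, hp₂⟩)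
      have hβ₁p₂ : (Sum.inr (Sum.inr β₁) : T'.Node) ∈ p₂.support := by
        have : p₂.getVert 1 = Sum.inr (Sum.inr β₁) := by
          simp only [p₂, SimpleGraph.Walk.getVert_copy, SimpleGraph.Walk.drop_getVert]
          exact h3
        rw [← this]
        exact p₂.getVert_mem_support 1
      have hβ₁W' : (Sum.inr (Sum.inr β₁) : T'.Node) ∈ W'.support := by
        rw [← hb] at hβ₁p₂
        exact W'.support_bypass_subset_support hβ₁p₂
      obtain ⟨m, hm, hmle⟩ := SimpleGraph.Walk.mem_support_iff_exists_getVert.mp hβ₁W'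
      have hm' : W.getVert (t₀ + 1 + m) = Sum.inr (Sum.inr β₁) := by
        simpa only [W', SimpleGraph.Walk.getVert_copy, SimpleGraph.Walk.drop_getVert] using hm
      have hlen' : W'.length = W.length - (t₀ + 1) := by
        simp only [W', SimpleGraph.Walk.length_copy, SimpleGraph.Walk.drop_length]
      exact hmax (t₀ + 1 + m) (by omega) (by omega) hm'
    · have hwu : w = u := by rw [hβ₁u] at hw; exact (Option.some_injective _ hw).symm
      rw [hE, hwu]
  -- `u ≠ f x₂`, so the walk goes on: the node after `u` is a branch `β ≠ β₁` at `u`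
  have ht₁lt : t₀ + 1 < W.length := by
    rcases Nat.lt_or_ge (t₀ + 1) W.length with hlt | hge
    · exact hlt
    · exfalso
      have heq : W.getVert (t₀ + 1) = Sum.inl (f.vertexMap x₂) := by
        rw [le_antisymm (by omega) hge]; exact W.getVert_length
      rw [hstep] at heq
      have hux : p.getVert 4 = p.getVert p.length := by rw [h4u, heq, p.getVert_length]
      have := hp.getVert_injOn (by simp; omega) (by simp) hux
      omega
  obtain ⟨β, hβu, hstep2⟩ : ∃ β : T'.Branch, T'.abuts β = some u ∧
      W.getVert (t₀ + 2) = Sum.inr (Sum.inr β) := by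
    have hadj := W.adj_getVert_succ ht₁lt
    rw [hstep, subdivision_adj_inl_iff] at hadj
    exact hadj
  have hββ₁ : β ≠ β₁ := by
    intro hb
    exact hmax (t₀ + 2) (by omega) (by omega) (by rw [hstep2, hb])
  -- lift the three nodes along `q`
  obtain ⟨δ₁, hqt₀, hδ₁⟩ : ∃ δ₁ : T.Branch, q.getVert t₀ = Sum.inr (Sum.inr δ₁) ∧
      f.branchMap δ₁ = β₁ := by
    have e := hWq t₀
    rw [ht₀] at e
    rcases hq0 : q.getVert t₀ with w | e' | b
    · rw [hq0, hΦv] at e; exact absurd e.symm Sum.inl_ne_inr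
    · rw [hq0, hΦe] at e; simp at e
    · rw [hq0, hΦb] at e
      exact ⟨b, rfl, (Sum.inr_injective (Sum.inr_injective e)).symm⟩
  obtain ⟨y, hqt₁, hy⟩ : ∃ y : T.Vertex, q.getVert (t₀ + 1) = Sum.inl y ∧ f.vertexMap y = u := by
    have e := hWq (t₀ + 1)
    rw [hstep] at e
    rcases hq1 : q.getVert (t₀ + 1) with w | e' | b
    · rw [hq1, hΦv] at e; exact ⟨w, rfl, (Sum.inl_injective e).symm⟩
    · rw [hq1, hΦe] at e; exact absurd e Sum.inl_ne_inr
    · rw [hq1, hΦb] at e; exact absurd e Sum.inl_ne_inr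
  obtain ⟨δ, hqt₂, hδ⟩ : ∃ δ : T.Branch, q.getVert (t₀ + 2) = Sum.inr (Sum.inr δ) ∧
      f.branchMap δ = β := by
    have e := hWq (t₀ + 2)
    rw [hstep2] at e
    rcases hq2 : q.getVert (t₀ + 2) with w | e' | b
    · rw [hq2, hΦv] at e; exact absurd e.symm Sum.inl_ne_inr
    · rw [hq2, hΦe] at e; simp at e
    · rw [hq2, hΦb] at e
      exact ⟨b, rfl, (Sum.inr_injective (Sum.inr_injective e)).symm⟩
  -- adjacency along `q` gives the abutments
  have hq₀lt : t₀ < q.length := by rw [← hWlen]; exact ht₀lt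
  have hq₁lt : t₀ + 1 < q.length := by rw [← hWlen]; exact ht₁lt
  have hδ₁y : T.abuts δ₁ = some y := by
    have hadj := q.adj_getVert_succ hq₀lt
    rw [hqt₀, hqt₁, subdivision_adj_branch_iff] at hadj
    rcases hadj with hE | ⟨w, hw, hE⟩
    · exact absurd hE Sum.inl_ne_inr
    · rw [hw, Sum.inl_injective hE]
  have hδy : T.abuts δ = some y := by
    have hadj := q.adj_getVert_succ hq₁lt
    rw [hqt₁, subdivision_adj_inl_iff] at hadj
    obtain ⟨b, hb, hE⟩ := hadj
    rw [hqt₂] at hE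
    rw [Sum.inr_injective (Sum.inr_injective hE)]
    exact hb
  have hne : δ₁ ≠ δ := by
    intro hd
    apply hββ₁
    rw [← hδ, ← hd, hδ₁]
  -- `C` fixes the geodesic `q` pointwise
  have hAK : T.subdivision.IsAcyclic := hT.isTree.isAcyclic
  refine ⟨y, δ₁, δ, hne, hδ₁y, hδy, hy, hδ₁, by rw [hδ]; exact hββ₁, by rw [hδ]; exact hβu,
    fun γ => ?_⟩
  have hfix : ∀ z ∈ q.support, nodeMap (ρ γ) z = z :=
    nodeMap_eq_self_of_isPath hAK (ρ γ) (x := Sum.inl x₁) (y := Sum.inl x₂)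
      (by simp only [nodeMap, Sum.map_inl, hfx₁]) (by simp only [nodeMap, Sum.map_inl, hfx₂]) q hqpath
  have f0 := hfix _ (q.getVert_mem_support t₀)
  have f1 := hfix _ (q.getVert_mem_support (t₀ + 1))
  have f2 := hfix _ (q.getVert_mem_support (t₀ + 2))
  rw [hqt₀] at f0
  rw [hqt₁] at f1
  rw [hqt₂] at f2
  exact ⟨Sum.inl_injective f1, Sum.inr_injective (Sum.inr_injective f0),
    Sum.inr_injective (Sum.inr_injective f2)⟩

/-- **No unfolded fixed subjoint ⇒ images of fixed vertices are equal or adjacent** ([SemiAnbd] p. 41,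
"if `H` fixes two vertices of `𝒢_{∞,j}`, then these two vertices are joined to one another by a single
edge", for the IMAGES at a lower level): if no `C`-fixed subjoint `(y; δ₁ ≠ δ)` of the tree `T` is unfolded
by `f : T ⟶ T'` (i.e. has `f δ₁ ≠ f δ`), then for `C`-fixed vertices `x₁, x₂` of `T` the images
`f x₁, f x₂` are equal or joined by an edge of `T'`: otherwise their geodesic in `T'` has length `> 4` and
the crossing lemma produces an unfolded `C`-fixed subjoint. [cite: MochizukiSemiAnbd2006, Thm. 3.7(iii) p.41] -/
theorem eq_or_joins_of_noUnfoldedFixedSubjoint (hT : T.IsTree) (hT' : T'.IsTree)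
    (ρ : P →* Aut T) (f : T ⟶ T')
    (hno : ∀ (y : T.Vertex) (δ₁ δ : T.Branch), δ₁ ≠ δ → T.abuts δ₁ = some y → T.abuts δ = some y →
      (∀ γ : C, (ρ γ).hom.vertexMap y = y ∧ (ρ γ).hom.branchMap δ₁ = δ₁ ∧ (ρ γ).hom.branchMap δ = δ) →
      f.branchMap δ₁ = f.branchMap δ)
    (x₁ x₂ : T.Vertex)
    (hfx₁ : ∀ γ : C, (ρ γ).hom.vertexMap x₁ = x₁) (hfx₂ : ∀ γ : C, (ρ γ).hom.vertexMap x₂ = x₂) :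
    f.vertexMap x₁ = f.vertexMap x₂ ∨ ∃ e : T'.Edge, T'.Joins e (f.vertexMap x₁) (f.vertexMap x₂) := by
  classical
  by_cases heq : f.vertexMap x₁ = f.vertexMap x₂
  · exact Or.inl heq
  right
  obtain ⟨p, hplen⟩ :=
    hT'.isTree.connected.exists_walk_length_eq_dist (Sum.inl (f.vertexMap x₁)) (Sum.inl (f.vertexMap x₂))
  have hp : p.IsPath := p.isPath_of_length_eq_dist hplen
  obtain ⟨h4le, c₁, c₁', e₁, v₁, hcc, hc₁e, hc₁'e, hc₁w, hc₁'v, -, hx2, hx3, hx4⟩ :=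
    path_inl_prefix heq p hp
  rcases (Nat.lt_or_ge 4 p.length) with hlt | hge
  · -- length `> 4`: an interior vertex, hence an unfolded fixed subjoint — excluded
    exfalso
    obtain ⟨y, δ₁, δ, hne, hδ₁y, hδy, -, hδ₁, hδβ₁, -, hfix⟩ :=
      exists_fixedSubjoint_lastDeparture_of_fixed C hT hT' ρ f x₁ x₂ hfx₁ hfx₂ p hp hlt hx2 hx3 hx4
        hc₁'e hc₁'v
    exact hδβ₁ (by rw [← hno y δ₁ δ hne hδ₁y hδy hfix, hδ₁])
  · -- length `= 4`: the two images are joined by the edge at node `2`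
    have h4 : p.length = 4 := le_antisymm hge h4le
    obtain ⟨e, c, c', hcc', hce, hc'e, hcw, hc'w, -⟩ := joins_of_path_length_four heq p hp h4
    exact ⟨e, c, c', hcc', hce, hc'e, hcw, hc'w⟩

/-- **No unfolded fixed subjoint ⇒ at most two distinct images** (a tree has no triangle,
`IsTree.no_triangle`): under the same hypothesis, among the images of any three `C`-fixed vertices of `T`
two coincide. [cite: MochizukiSemiAnbd2006, Thm. 3.7(iii) p.41] -/
theorem image_fixed_pairwise_third (hT : T.IsTree) (hT' : T'.IsTree)
    (ρ : P →* Aut T) (f : T ⟶ T')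
    (hno : ∀ (y : T.Vertex) (δ₁ δ : T.Branch), δ₁ ≠ δ → T.abuts δ₁ = some y → T.abuts δ = some y →
      (∀ γ : C, (ρ γ).hom.vertexMap y = y ∧ (ρ γ).hom.branchMap δ₁ = δ₁ ∧ (ρ γ).hom.branchMap δ = δ) →
      f.branchMap δ₁ = f.branchMap δ)
    (x₁ x₂ x₃ : T.Vertex)
    (hfx₁ : ∀ γ : C, (ρ γ).hom.vertexMap x₁ = x₁) (hfx₂ : ∀ γ : C, (ρ γ).hom.vertexMap x₂ = x₂)
    (hfx₃ : ∀ γ : C, (ρ γ).hom.vertexMap x₃ = x₃) :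
    f.vertexMap x₁ = f.vertexMap x₂ ∨ f.vertexMap x₂ = f.vertexMap x₃ ∨
      f.vertexMap x₁ = f.vertexMap x₃ := by
  by_contra h
  push Not at h
  obtain ⟨h12, h23, h13⟩ := h
  have j12 := (eq_or_joins_of_noUnfoldedFixedSubjoint C hT hT' ρ f hno x₁ x₂ hfx₁ hfx₂).resolve_left h12
  have j23 := (eq_or_joins_of_noUnfoldedFixedSubjoint C hT hT' ρ f hno x₂ x₃ hfx₂ hfx₃).resolve_left h23
  have j13 := (eq_or_joins_of_noUnfoldedFixedSubjoint C hT hT' ρ f hno x₁ x₃ hfx₁ hfx₃).resolve_left h13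
  obtain ⟨e₁, he₁⟩ := j12
  obtain ⟨e₂, he₂⟩ := j23
  obtain ⟨e₃, he₃⟩ := j13
  exact hT'.no_triangle h12 h23 h13 he₁ he₂ he₃

/-- **No unfolded fixed subjoint ⇒ the image of the fixed locus is finite** (indeed has at most two
elements): the set of images under `f` of the `C`-fixed vertices of `T` is finite — the hypothesis `hfin`
of abc-iut-w6-d066's `VerticialLevelData.hfix_of_eventually_finite_images` at one transition.
[cite: MochizukiSemiAnbd2006, Thm. 3.7(iii) p.41] -/
theorem finite_image_fixed_of_noUnfoldedFixedSubjoint (hT : T.IsTree) (hT' : T'.IsTree)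
    (ρ : P →* Aut T) (f : T ⟶ T')
    (hno : ∀ (y : T.Vertex) (δ₁ δ : T.Branch), δ₁ ≠ δ → T.abuts δ₁ = some y → T.abuts δ = some y →
      (∀ γ : C, (ρ γ).hom.vertexMap y = y ∧ (ρ γ).hom.branchMap δ₁ = δ₁ ∧ (ρ γ).hom.branchMap δ = δ) →
      f.branchMap δ₁ = f.branchMap δ) :
    (f.vertexMap '' {x : T.Vertex | ∀ γ : C, (ρ γ).hom.vertexMap x = x}).Finite := by
  classical
  by_cases hS : (f.vertexMap '' {x : T.Vertex | ∀ γ : C, (ρ γ).hom.vertexMap x = x}).Nonempty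
  · obtain ⟨_, x₁, hx₁, rfl⟩ := hS
    -- every image is `f x₁` or joined to it; and two images `≠ f x₁` coincide
    by_cases hT2 : ∃ x₂ : T.Vertex, (∀ γ : C, (ρ γ).hom.vertexMap x₂ = x₂) ∧ f.vertexMap x₂ ≠ f.vertexMap x₁
    · obtain ⟨x₂, hx₂, h21⟩ := hT2
      refine ((Set.finite_singleton (f.vertexMap x₂)).insert (f.vertexMap x₁)).subset ?_
      rintro _ ⟨x₃, hx₃, rfl⟩
      rcases image_fixed_pairwise_third C hT hT' ρ f hno x₁ x₂ x₃ hx₁ hx₂ hx₃ with h | h | h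
      · exact absurd h.symm h21
      · exact Set.mem_insert_of_mem _ h.symm
      · exact h ▸ Set.mem_insert _ _
    · push Not at hT2
      refine (Set.finite_singleton (f.vertexMap x₁)).subset ?_
      rintro _ ⟨x₃, hx₃, rfl⟩
      exact hT2 x₃ hx₃
  · rw [Set.not_nonempty_iff_eq_empty] at hS
    rw [hS]
    exact Set.finite_empty

end OneTransition

end SemiGraph

end Literature.AnabelianGeometry.SemiGraphs
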